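import Summits.Ventures.HodgeRepro2.T5SU11ResolventDifferenceWeightedL1
import Summits.Ventures.HodgeRepro2.T5SU11KernelDiagonalMuDerivativeOrigin
import Summits.Ventures.HodgeRepro2.T5SU11KernelDifferenceCorner

/-!
# Summary XXXV — the resolvent difference on the `Ξ`-weighted `L¹` class, the spectral derivative of the diagonal at the origin,
and the difference of two kernels at the corner (rows 655–657), under uniform names

* `resolvent_sub_weighted` — **`|G^I_λ g − G^I_{λ₂} g|(t) ≤ C Ξ(t) ∫ Ξ |g| sinh 2s ds`** on the disc (row 655);
* `diagonal_mu_deriv_origin` — **`∂_μ K_λ(t, t) = ∫ K_λ(t, r)² sinh 2r dr → ∫ χ_λ² sinh 2r dr` as `t → 0⁺`** (row 656);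
* `kernel_sub_corner` — **`K_λ(t, s) − K_{λ₂}(t, s) → (μ − μ₂) ∫ χ_λ χ_{λ₂} sinh 2r dr` as `(t, s) → (0, 0)`** (row 657).

Nothing is claimed about (N).

Blind lane: Mathlib + the HodgeRepro2 prefix only; no sorry; axioms ⊆ {propext, Classical.choice,
Quot.sound}.
-/

namespace Summit.Ventures.HodgeRepro2.T5SU11RadialSummaryXXXV

open Filter Topology MeasureTheory
open Set (Ioi Ioc)
open T5SU11Cartan T5SU11SphericalFunction T5SU11SphericalDecay T5SU11RadialGreenKernel T5SU11RadialGreenImproper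
  T5SU11ResolventDifferenceWeightedL1 T5SU11KernelDiagonalMuDerivativeOrigin T5SU11KernelDifferenceCorner

section measure

variable [MeasurableSpace Circle] [BorelSpace Circle]

variable {lam lam₂ : ℝ} (hlam : 1 < lam) (hlam₂ : 1 < lam₂)

include hlam hlam₂ in
/-- **The resolvent difference on the `Ξ`-weighted `L¹` class** (row 655). -/
theorem resolvent_sub_weighted (hq : |lam * (lam - 2) - lam₂ * (lam₂ - 2)| < (lam₂ - 1) ^ 2) :
    ∃ C : ℝ, 0 < C ∧ ∀ g : ℝ → ℝ,
      (∀ T, IntegrableOn (fun s => sph lam (hyp s) * g s * Real.sinh (2 * s)) (Ioc 0 T)) →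
      IntegrableOn (fun s => sphDecay lam s * g s * Real.sinh (2 * s)) (Ioi 0) →
      (∀ T, IntegrableOn (fun s => sph lam₂ (hyp s) * g s * Real.sinh (2 * s)) (Ioc 0 T)) →
      IntegrableOn (fun s => sphDecay lam₂ s * g s * Real.sinh (2 * s)) (Ioi 0) →
      IntegrableOn (fun s => sph 1 (hyp s) * |g s| * Real.sinh (2 * s)) (Ioi 0) →
      ∀ t, 0 < t →
      |greenSolI (fun t => sph lam (hyp t)) (sphDecay lam) g t - greenSolI (fun t => sph lam₂ (hyp t)) (sphDecay lam₂) g t|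
        ≤ C * sph 1 (hyp t) * ∫ s in Ioi 0, sph 1 (hyp s) * |g s| * Real.sinh (2 * s) :=
  abs_greenSolI_sub_le_mul_sph_one_integral hlam hlam₂ hq

include hlam in
/-- **The spectral derivative of the diagonal at the origin** (row 656). -/
theorem diagonal_mu_deriv_origin :
    Tendsto (fun t => ∫ r in Ioi 0, sphGreenKernel lam t r ^ 2 * Real.sinh (2 * r)) (𝓝[>] 0)
      (𝓝 (∫ r in Ioi 0, sphDecay lam r * sphDecay lam r * Real.sinh (2 * r))) :=
  tendsto_integral_kernel_sq_nhdsGT_zero hlam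

include hlam hlam₂ in
/-- **The difference of two kernels at the corner** (row 657). -/
theorem kernel_sub_corner :
    Tendsto (fun p : ℝ × ℝ => sphGreenKernel lam p.1 p.2 - sphGreenKernel lam₂ p.1 p.2) (𝓝[>] 0 ×ˢ 𝓝[>] 0)
      (𝓝 ((lam * (lam - 2) - lam₂ * (lam₂ - 2)) * ∫ r in Ioi 0, sphDecay lam r * sphDecay lam₂ r * Real.sinh (2 * r))) :=
  tendsto_kernel_sub_corner hlam hlam₂

end measure

end Summit.Ventures.HodgeRepro2.T5SU11RadialSummaryXXXV
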